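import Literature.NumberTheory.Transcendental.BallRivoalLinearForms
import Literature.NumberTheory.Irrationality.Zudilin2003.CatalanRecursion
import HarnessLib

/-!
# Zudilin 2003, Lemma 1 (arithmetic half): `R_n` is a product of three integer-residue bricks

Source: W. Zudilin, *An Apéry-like difference equation for Catalan's constant*, Electron. J. Combin.
10 (2003), #R14, arXiv:math/0201024 [Zudilin2003Catalan], Sect. 2, proof of Lemma 1, (10)–(17).

HONEST FRAMING (cell `pub-zeta5`): systematic search; no irrationality claim unless certified.

The proof of Lemma 1 writes `R_n(t) = (2t+n+1) · P⁽¹⁾_n(t) · P⁽²⁾_n(t) · Q_n(t)³` ((10), (15)) with the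
integer-valued polynomials `P⁽¹⁾_n(t) = t(t-1)⋯(t-n+1)/n!`, `P⁽²⁾_n(t) = (t+n+1)⋯(t+2n)/n!` and
`Q_n(t) = n!/((t+½)⋯(t+n+½)) = Σ_l (-1)^l C(n,l)/(t+l+½)` ((13)), and deduces from
`2^{2n} P_n(-k-½) ∈ ℤ`, `2^{2n} D_n^j (1/j!) P_n^{(j)}(-k-½) ∈ ℤ` ((11)–(12), [Zu2, Lemma 7]) and (14)
that the partial-fraction coefficients `A_{jk}(n)` of
`R_n(t) = Σ_{j=0}^{2} Σ_{k=0}^{n} A_{jk}/(t+k+½)^{3-j}` ((17)) satisfy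
`2^{4n} D_n^j A_{jk}(n) ∈ ℤ` ((16)).

This file PROVES (16)–(17) through the tree's Ball–Rivoal brick calculus
(`Literature.NumberTheory.Transcendental.BallRivoal.{brickEval, pfEval, IsInt, lagrange_div,
exists_pf_prod}`), after the shift `t = τ + ½` (poles `t + k + ½ ↦ τ + k + 1`): for `n ≥ 1`,

* `sixteen_pow_mul_R_shift` — `16ⁿ R_n(τ+½) = B₀(τ) B₁(τ) B₂(τ)` with the three bricks
  `B_i(τ) = Σ_{m ≤ n} A^{(i)}_m/(τ+m+1)` of INTEGER residues
  `res0 n m = (-1)^m C(n,m) (n-2m)` (numerator `n!(2τ+n+2)`),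
  `res1 n m = (-1)^{n+m} C(2(m+n), m+n) C(m+n, 2m)` (numerator `4ⁿ (τ+3/2-n)_n = 4ⁿ n! P⁽¹⁾_n(τ+½)`),
  `res2 n m = (-1)^m C(2(2n-m), 2n-m) C(2n-m, m)` (numerator `4ⁿ (τ+n+3/2)_n = 4ⁿ n! P⁽²⁾_n(τ+½)`)
  — the integrality `4ⁿ · (half-integer binomial) ∈ ℤ` of (11) made explicit by
  `oddProd_identity` (`2ⁿ (2m+1)(2m+3)⋯(2m+2n-1) · (m+n)! (2m)! = (2m+2n)! m!`);
* `exists_pf_R` — hence partial-fraction data `c` with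
  `16ⁿ R_n(τ+½) = Σ_{p ≤ n} Σ_{o<3} c_{o,p}/(τ+p+1)^{o+1}` (`τ ∉ {-1,…,-(n+1)}`) and
  `d^{2-o} c_{o,p} ∈ ℤ` for every common multiple `d` of `1,…,n` (`BallRivoal.IsInt 3 d c`); with
  `A_{jk} = 16^{-n} c_{2-j,k}` this is (16)–(17): `2^{4n} d^j A_{jk} = d^j c_{2-j,k} ∈ ℤ`;
  `R_eq_pfEval` — the same at the original argument, `R_n(t) = 16^{-n} Σ c_{o,p}/(t+p+½)^{o+1}`,
  in particular at every `t ∈ ℕ` (`R_natCast_eq_pfEval`).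

Everything is PROVED (0 sorry); no named facts. The analytic half of Lemma 1 (summing over `t`
against `(-1)^t` to get `F_n = U_nβ(3) + U'_nβ(2) + U''_nβ(1) - V_n`) is not in this file.
-/

noncomputable section

open Finset Polynomial
open Literature.NumberTheory.Transcendental

namespace Literature.NumberTheory.Irrationality.Zudilin2003

/-! ### Half-integer Pochhammer values -/

/-- `2ⁿ (2m+1)(2m+3)⋯(2m+2n-1) · (m+n)! · (2m)! = (2m+2n)! · m!` (in `ℕ`).
[cite: Zudilin2003Catalan, Sect. 2, eq. (11)] -/
theorem oddProd_identity (m n : ℕ) :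
    (∏ s ∈ range n, (2 * m + 2 * s + 1)) * 2 ^ n * (m + n).factorial * (2 * m).factorial
      = (2 * m + 2 * n).factorial * m.factorial := by
  induction n with
  | zero => simp only [prod_range_zero, pow_zero, add_zero, mul_zero, one_mul]; ring
  | succ n ih =>
    rw [prod_range_succ, pow_succ, show m + (n + 1) = (m + n) + 1 by ring, Nat.factorial_succ,
      show 2 * m + 2 * (n + 1) = (2 * m + 2 * n + 1) + 1 by ring, Nat.factorial_succ,
      Nat.factorial_succ (2 * m + 2 * n)]
    have e : (∏ s ∈ range n, (2 * m + 2 * s + 1)) * (2 * m + 2 * n + 1) * (2 ^ n * 2) *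
        ((m + n + 1) * (m + n).factorial) * (2 * m).factorial
        = ((∏ s ∈ range n, (2 * m + 2 * s + 1)) * 2 ^ n * (m + n).factorial * (2 * m).factorial)
          * ((2 * m + 2 * n + 1) * (2 * (m + n + 1))) := by ring
    rw [e, ih]
    ring

/-- `4ⁿ (m+½)_n = (2m+2n)! m! / ((m+n)! (2m)!)` in `ℚ`. [cite: Zudilin2003Catalan, Sect. 2, eq. (11)] -/
theorem four_pow_mul_poch_half (m n : ℕ) :
    (4 : ℚ) ^ n * BallRivoal.poch ((m : ℚ) + 1 / 2) n
      = ((2 * m + 2 * n).factorial : ℚ) * (m.factorial : ℚ)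
        / (((m + n).factorial : ℚ) * ((2 * m).factorial : ℚ)) := by
  have h := oddProd_identity m n
  have hne : (((m + n).factorial : ℚ) * ((2 * m).factorial : ℚ)) ≠ 0 := by positivity
  rw [eq_div_iff hne]
  have hc : (((∏ s ∈ range n, (2 * m + 2 * s + 1)) * 2 ^ n * (m + n).factorial * (2 * m).factorial
      : ℕ) : ℚ) = (((2 * m + 2 * n).factorial * m.factorial : ℕ) : ℚ) := by rw [h]
  push_cast at hc
  have hp : BallRivoal.poch ((m : ℚ) + 1 / 2) n * 2 ^ n
      = ∏ s ∈ range n, (2 * (m : ℚ) + 2 * (s : ℚ) + 1) := by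
    rw [BallRivoal.poch, show ((2 : ℚ)) ^ n = ∏ _s ∈ range n, (2 : ℚ) by rw [prod_const, card_range],
      ← prod_mul_distrib]
    refine prod_congr rfl fun s _ => ?_
    ring
  rw [show (4 : ℚ) ^ n = 2 ^ n * 2 ^ n by rw [← mul_pow]; norm_num]
  linear_combination (2 : ℚ) ^ n * ((m + n).factorial : ℚ) * ((2 * m).factorial : ℚ) * hp + hc

/-! ### The three bricks -/

/-- Residues of `B₀(τ) = n!(2τ+n+2)/(τ+1)_{n+1}`: `(-1)^m C(n,m) (n-2m)`.
[cite: Zudilin2003Catalan, Sect. 2, eqs. (13), (15)] -/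
def res0 (n m : ℕ) : ℤ := (-1) ^ m * (n.choose m : ℤ) * ((n : ℤ) - 2 * m)

/-- Residues of `B₁(τ) = 4ⁿ(τ+3/2-n)_n/(τ+1)_{n+1}`: `(-1)^{n+m} C(2(m+n), m+n) C(m+n, 2m)` — the
integrality `2^{2n} P⁽¹⁾_n(-m-½)·(…) ∈ ℤ` of (11). [cite: Zudilin2003Catalan, Sect. 2, eqs. (10)–(11)] -/
def res1 (n m : ℕ) : ℤ :=
  (-1) ^ (n + m) * ((2 * (m + n)).choose (m + n) : ℤ) * ((m + n).choose (2 * m) : ℤ)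

/-- Residues of `B₂(τ) = 4ⁿ(τ+n+3/2)_n/(τ+1)_{n+1}`: `(-1)^m C(2(2n-m), 2n-m) C(2n-m, m)`.
[cite: Zudilin2003Catalan, Sect. 2, eqs. (10)–(11)] -/
def res2 (n m : ℕ) : ℤ :=
  (-1) ^ m * ((2 * (2 * n - m)).choose (2 * n - m) : ℤ) * ((2 * n - m).choose m : ℤ)

/-- The three bricks by index `0, 1, 2` (any other index: `res2`). [cite: Zudilin2003Catalan, Sect. 2, eq. (15)] -/
def brickRes (n : ℕ) : ℕ → ℕ → ℤ
  | 0 => res0 n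
  | 1 => res1 n
  | _ => res2 n

/-- `(τ+1)_{n+1} ≠ 0` away from the poles. [folklore] -/
private theorem poch_succ_ne_zero (n : ℕ) (τ : ℚ) (hτ : ∀ m, m ≤ n → τ + m + 1 ≠ 0) :
    BallRivoal.poch (τ + 1) (n + 1) ≠ 0 := by
  rw [BallRivoal.poch]
  exact prod_ne_zero_iff.2 fun m hm => by
    have := hτ m (Nat.lt_succ_iff.1 (mem_range.1 hm))
    intro h; apply this; linarith

/-- **Brick `B₀`**: `n!(2τ+n+2)/(τ+1)_{n+1} = Σ_m res0 n m/(τ+m+1)` (`n ≥ 1`, so that the numerator has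
degree `≤ n`). [cite: Zudilin2003Catalan, Sect. 2, eqs. (13)–(15)] -/
theorem brick0_eq (n : ℕ) (hn : 1 ≤ n) (τ : ℚ) (hτ : ∀ m, m ≤ n → τ + m + 1 ≠ 0) :
    (n.factorial : ℚ) * (2 * τ + n + 2) / BallRivoal.poch (τ + 1) (n + 1)
      = BallRivoal.brickEval n (res0 n) τ := by
  set P : ℚ[X] := C (2 * (n.factorial : ℚ)) * X + C ((n.factorial : ℚ) * (n + 2)) with hP
  have hdeg : P.degree < ((n + 1 : ℕ) : WithBot ℕ) := by
    refine (degree_linear_le).trans_lt ?_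
    exact_mod_cast (show 1 < n + 1 by omega)
  have hev : ∀ x : ℚ, P.eval x = (n.factorial : ℚ) * (2 * x + n + 2) := by
    intro x; rw [hP, eval_add, eval_mul, eval_C, eval_X, eval_C]; ring
  have h := BallRivoal.lagrange_div n P hdeg τ hτ
  rw [hev] at h
  rw [h, BallRivoal.brickEval]
  refine sum_congr rfl fun m hm => ?_
  have hm' : m ≤ n := Nat.lt_succ_iff.1 (mem_range.1 hm)
  rw [hev, res0]
  push_cast
  rw [Nat.cast_choose ℚ hm']
  have hf : ((m.factorial : ℚ) * (n - m).factorial) ≠ 0 := by positivity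
  field_simp
  ring

/-- **Brick `B₁`**: `4ⁿ(τ+3/2-n)_n/(τ+1)_{n+1} = Σ_m res1 n m/(τ+m+1)`.
[cite: Zudilin2003Catalan, Sect. 2, eqs. (10)–(11), (15)] -/
theorem brick1_eq (n : ℕ) (τ : ℚ) (hτ : ∀ m, m ≤ n → τ + m + 1 ≠ 0) :
    (4 : ℚ) ^ n * BallRivoal.poch (τ + (3 / 2 - n)) n / BallRivoal.poch (τ + 1) (n + 1)
      = BallRivoal.brickEval n (res1 n) τ := by
  set P : ℚ[X] := C ((4 : ℚ) ^ n) * BallRivoal.pochPoly (3 / 2 - n) n with hP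
  have hdeg : P.degree < ((n + 1 : ℕ) : WithBot ℕ) := by
    rw [hP, degree_C_mul (by positivity)]; exact BallRivoal.degree_pochPoly_lt _ _
  have hev : ∀ x : ℚ, P.eval x = (4 : ℚ) ^ n * BallRivoal.poch (x + (3 / 2 - n)) n := by
    intro x; rw [hP, eval_mul, eval_C, BallRivoal.eval_pochPoly]
  have h := BallRivoal.lagrange_div n P hdeg τ hτ
  rw [hev] at h
  rw [h, BallRivoal.brickEval]
  refine sum_congr rfl fun m hm => ?_
  have hm' : m ≤ n := Nat.lt_succ_iff.1 (mem_range.1 hm)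
  rw [hev, res1]
  -- `(−m−1 + 3/2 − n)_n = (−1)^n (m+½)_n`, then `four_pow_mul_poch_half`
  have hrefl : BallRivoal.poch (-(m : ℚ) - 1 + (3 / 2 - n)) n
      = (-1) ^ n * BallRivoal.poch ((m : ℚ) + 1 / 2) n := by
    rw [← BallRivoal.poch_reflect]; congr 1; ring
  rw [hrefl, show (4 : ℚ) ^ n * ((-1) ^ n * BallRivoal.poch ((m : ℚ) + 1 / 2) n)
      = (-1) ^ n * ((4 : ℚ) ^ n * BallRivoal.poch ((m : ℚ) + 1 / 2) n) by ring,
    four_pow_mul_poch_half]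
  have h1 : (2 * (m + n)).choose (m + n) * (m + n).factorial * (m + n).factorial
      = (2 * (m + n)).factorial := by
    have := Nat.choose_mul_factorial_mul_factorial (show m + n ≤ 2 * (m + n) by omega)
    rwa [show 2 * (m + n) - (m + n) = m + n by omega] at this
  have h2 : (m + n).choose (2 * m) * (2 * m).factorial * (n - m).factorial = (m + n).factorial := by
    have := Nat.choose_mul_factorial_mul_factorial (show 2 * m ≤ m + n by omega)
    rwa [show m + n - 2 * m = n - m by omega] at this
  have h1' : (((2 * (m + n)).choose (m + n) : ℕ) : ℚ)
      = ((2 * (m + n)).factorial : ℚ) / (((m + n).factorial : ℚ) * ((m + n).factorial : ℚ)) := by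
    rw [eq_div_iff (by positivity)]; exact_mod_cast (by rw [← h1]; ring)
  have h2' : (((m + n).choose (2 * m) : ℕ) : ℚ)
      = ((m + n).factorial : ℚ) / (((2 * m).factorial : ℚ) * ((n - m).factorial : ℚ)) := by
    rw [eq_div_iff (by positivity)]; exact_mod_cast (by rw [← h2]; ring)
  push_cast
  rw [h1', h2', show 2 * (m : ℕ) + 2 * n = 2 * (m + n) by ring]
  have hf1 : ((m.factorial : ℚ)) ≠ 0 := by positivity
  have hf2 : (((n - m).factorial : ℚ)) ≠ 0 := by positivity
  have hf3 : (((m + n).factorial : ℚ)) ≠ 0 := by positivity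
  have hf4 : (((2 * m).factorial : ℚ)) ≠ 0 := by positivity
  field_simp
  ring

/-- **Brick `B₂`**: `4ⁿ(τ+n+3/2)_n/(τ+1)_{n+1} = Σ_m res2 n m/(τ+m+1)`.
[cite: Zudilin2003Catalan, Sect. 2, eqs. (10)–(11), (15)] -/
theorem brick2_eq (n : ℕ) (τ : ℚ) (hτ : ∀ m, m ≤ n → τ + m + 1 ≠ 0) :
    (4 : ℚ) ^ n * BallRivoal.poch (τ + (n + 3 / 2)) n / BallRivoal.poch (τ + 1) (n + 1)
      = BallRivoal.brickEval n (res2 n) τ := by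
  set P : ℚ[X] := C ((4 : ℚ) ^ n) * BallRivoal.pochPoly (n + 3 / 2) n with hP
  have hdeg : P.degree < ((n + 1 : ℕ) : WithBot ℕ) := by
    rw [hP, degree_C_mul (by positivity)]; exact BallRivoal.degree_pochPoly_lt _ _
  have hev : ∀ x : ℚ, P.eval x = (4 : ℚ) ^ n * BallRivoal.poch (x + (n + 3 / 2)) n := by
    intro x; rw [hP, eval_mul, eval_C, BallRivoal.eval_pochPoly]
  have h := BallRivoal.lagrange_div n P hdeg τ hτ
  rw [hev] at h
  rw [h, BallRivoal.brickEval]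
  refine sum_congr rfl fun m hm => ?_
  have hm' : m ≤ n := Nat.lt_succ_iff.1 (mem_range.1 hm)
  rw [hev, res2]
  -- `−m−1 + n + 3/2 = (n−m) + ½`
  have hshift : (-(m : ℚ) - 1 + (n + 3 / 2)) = ((n - m : ℕ) : ℚ) + 1 / 2 := by
    rw [Nat.cast_sub hm']; ring
  rw [hshift, four_pow_mul_poch_half]
  have e1 : 2 * (n - m) + 2 * n = 2 * (2 * n - m) := by omega
  have e2 : n - m + n = 2 * n - m := by omega
  rw [e1, e2]
  have h1 : (2 * (2 * n - m)).choose (2 * n - m) * (2 * n - m).factorial * (2 * n - m).factorial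
      = (2 * (2 * n - m)).factorial := by
    have := Nat.choose_mul_factorial_mul_factorial (show 2 * n - m ≤ 2 * (2 * n - m) by omega)
    rwa [show 2 * (2 * n - m) - (2 * n - m) = 2 * n - m by omega] at this
  have h2 : (2 * n - m).choose m * m.factorial * (2 * (n - m)).factorial = (2 * n - m).factorial := by
    have := Nat.choose_mul_factorial_mul_factorial (show m ≤ 2 * n - m by omega)
    rwa [show 2 * n - m - m = 2 * (n - m) by omega] at this
  have h1' : (((2 * (2 * n - m)).choose (2 * n - m) : ℕ) : ℚ)
      = ((2 * (2 * n - m)).factorial : ℚ)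
        / (((2 * n - m).factorial : ℚ) * ((2 * n - m).factorial : ℚ)) := by
    rw [eq_div_iff (by positivity)]; exact_mod_cast (by rw [← h1]; ring)
  have h2' : (((2 * n - m).choose m : ℕ) : ℚ)
      = ((2 * n - m).factorial : ℚ) / ((m.factorial : ℚ) * ((2 * (n - m)).factorial : ℚ)) := by
    rw [eq_div_iff (by positivity)]; exact_mod_cast (by rw [← h2]; ring)
  push_cast
  rw [h1', h2']
  have hf1 : ((m.factorial : ℚ)) ≠ 0 := by positivity
  have hf2 : (((n - m).factorial : ℚ)) ≠ 0 := by positivity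
  have hf3 : (((2 * n - m).factorial : ℚ)) ≠ 0 := by positivity
  have hf4 : (((2 * (n - m)).factorial : ℚ)) ≠ 0 := by positivity
  field_simp

/-! ### `16ⁿ R_n(τ + ½)` is the product of the three bricks -/

/-- The three factors of `R_n` at `t = τ + ½` as Pochhammer products:
`∏_{j≤n}(τ+½+j+½) = (τ+1)_{n+1}`, `∏_{j<n}(τ+½-j) = (τ+3/2-n)_n`, `∏_{j<n}(τ+½+n+1+j) = (τ+n+3/2)_n`.
[cite: Zudilin2003Catalan, Sect. 2, eqs. (7), (10)] -/
theorem R_shift_factors (n : ℕ) (τ : ℚ) :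
    (∏ j ∈ range (n + 1), (τ + 1 / 2 + j + 1 / 2)) = BallRivoal.poch (τ + 1) (n + 1)
    ∧ (∏ j ∈ range n, (τ + 1 / 2 - j)) = BallRivoal.poch (τ + (3 / 2 - n)) n
    ∧ (∏ j ∈ range n, (τ + 1 / 2 + n + 1 + j)) = BallRivoal.poch (τ + (n + 3 / 2)) n := by
  refine ⟨?_, ?_, ?_⟩
  · rw [BallRivoal.poch]; exact prod_congr rfl fun j _ => by ring
  · rw [BallRivoal.poch, ← prod_range_reflect]
    refine prod_congr rfl fun j hj => ?_
    have hj' : j < n := mem_range.1 hj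
    rw [Nat.cast_sub (by omega : j ≤ n - 1), Nat.cast_sub (by omega : 1 ≤ n)]
    push_cast; ring
  · rw [BallRivoal.poch]; exact prod_congr rfl fun j _ => by ring

/-- **`16ⁿ R_n(τ+½) = B₀(τ) B₁(τ) B₂(τ)`** for `n ≥ 1` and `τ ∉ {-1,…,-(n+1)}`.
[cite: Zudilin2003Catalan, Sect. 2, eq. (15)] -/
theorem sixteen_pow_mul_R_shift (n : ℕ) (hn : 1 ≤ n) (τ : ℚ) (hτ : ∀ m, m ≤ n → τ + m + 1 ≠ 0) :
    (16 : ℚ) ^ n * R n (τ + 1 / 2)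
      = BallRivoal.brickEval n (res0 n) τ * BallRivoal.brickEval n (res1 n) τ
        * BallRivoal.brickEval n (res2 n) τ := by
  obtain ⟨h0, h1, h2⟩ := R_shift_factors n τ
  have hC := poch_succ_ne_zero n τ hτ
  rw [← brick0_eq n hn τ hτ, ← brick1_eq n τ hτ, ← brick2_eq n τ hτ, R, h0, h1, h2,
    show (16 : ℚ) ^ n = 4 ^ n * 4 ^ n by rw [← mul_pow]; norm_num]
  field_simp
  ring

/-- The product of the three bricks as `∏_{s<3}`. [cite: Zudilin2003Catalan, Sect. 2, eq. (15)] -/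
theorem prod_brickRes (n : ℕ) (τ : ℚ) :
    ∏ s ∈ range 3, BallRivoal.brickEval n (brickRes n s) τ
      = BallRivoal.brickEval n (res0 n) τ * BallRivoal.brickEval n (res1 n) τ
        * BallRivoal.brickEval n (res2 n) τ := by
  rw [show (3 : ℕ) = 0 + 1 + 1 + 1 by rfl, prod_range_succ, prod_range_succ, prod_range_succ,
    prod_range_zero, one_mul]
  rfl

/-! ### The partial fractions (17) with the inclusions (16) -/

/-- **Lemma 1, (16)–(17).** For `n ≥ 1` and any common multiple `d` of `1,…,n` there are partial-fraction
data `c` (`c_{o,p}`, `o < 3`, `p ≤ n`) with `16ⁿ R_n(τ+½) = Σ_{p≤n} Σ_{o<3} c_{o,p}/(τ+p+1)^{o+1}` away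
from the poles and `d^{2-o} c_{o,p} ∈ ℤ`; i.e. `A_{jk}(n) = 16^{-n} c_{2-j,k}` are the coefficients of
(17) and `2^{4n} d^j A_{jk}(n) ∈ ℤ` is (16). [cite: Zudilin2003Catalan, Lemma 1, eqs. (16)–(17)] -/
theorem exists_pf_R (n d : ℕ) (hn : 1 ≤ n) (hdiv : ∀ k : ℕ, 1 ≤ k → k ≤ n → (k : ℤ) ∣ d) :
    ∃ c : ℕ → ℕ → ℚ,
      (∀ τ : ℚ, (∀ m, m ≤ n → τ + m + 1 ≠ 0) →
        BallRivoal.pfEval n 3 c τ = (16 : ℚ) ^ n * R n (τ + 1 / 2)) ∧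
      BallRivoal.IsInt 3 d c := by
  obtain ⟨c, hc, hint, -⟩ := BallRivoal.exists_pf_prod n d hdiv (brickRes n) 3 (by norm_num)
  refine ⟨c, fun τ hτ => ?_, hint⟩
  rw [hc τ hτ, prod_brickRes, sixteen_pow_mul_R_shift n hn τ hτ]

/-- `j ∣ D_n = lcm(1,…,n)` for `1 ≤ j ≤ n` (`Nat.lcmUpto`). [folklore] -/
private theorem natCast_dvd_lcmUpto_int {j n : ℕ} (h1 : 1 ≤ j) (h2 : j ≤ n) :
    (j : ℤ) ∣ (Nat.lcmUpto n : ℕ) := by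
  have : j ∈ Icc 1 n := mem_Icc.2 ⟨h1, h2⟩
  have h := Finset.dvd_lcm (f := id) this
  have h' : j ∣ Nat.lcmUpto n := by simpa [Nat.lcmUpto] using h
  exact_mod_cast h'

/-- **(16)–(17) with `d = D_n`**: pf data `c` of `16ⁿ R_n(τ+½)` with `D_n^{2-o} c_{o,p} ∈ ℤ`.
[cite: Zudilin2003Catalan, Lemma 1, eq. (16)] -/
theorem exists_pf_R_lcmUpto (n : ℕ) (hn : 1 ≤ n) :
    ∃ c : ℕ → ℕ → ℚ,
      (∀ τ : ℚ, (∀ m, m ≤ n → τ + m + 1 ≠ 0) →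
        BallRivoal.pfEval n 3 c τ = (16 : ℚ) ^ n * R n (τ + 1 / 2)) ∧
      BallRivoal.IsInt 3 (Nat.lcmUpto n) c :=
  exists_pf_R n (Nat.lcmUpto n) hn fun _ h1 h2 => natCast_dvd_lcmUpto_int h1 h2

/-- **(17) at the original argument**: if `c` expands `16ⁿ R_n(τ+½)`, then for `t ∉ {-½, …, -n-½}`
`R_n(t) = 16^{-n} Σ_{p≤n} Σ_{o<3} c_{o,p}/(t+p+½)^{o+1}`. [cite: Zudilin2003Catalan, Lemma 1, eq. (17)] -/
theorem R_eq_pfEval (n : ℕ) (c : ℕ → ℕ → ℚ)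
    (hc : ∀ τ : ℚ, (∀ m, m ≤ n → τ + m + 1 ≠ 0) →
      BallRivoal.pfEval n 3 c τ = (16 : ℚ) ^ n * R n (τ + 1 / 2))
    (t : ℚ) (ht : ∀ k, k ≤ n → t + k + 1 / 2 ≠ 0) :
    R n t = ((16 : ℚ) ^ n)⁻¹ * ∑ p ∈ range (n + 1), ∑ o ∈ range 3, c o p / (t + p + 1 / 2) ^ (o + 1) := by
  have hτ : ∀ m, m ≤ n → (t - 1 / 2) + m + 1 ≠ 0 := fun m hm h => ht m hm (by linarith)
  have h := hc (t - 1 / 2) hτ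
  rw [sub_add_cancel] at h
  have e : BallRivoal.pfEval n 3 c (t - 1 / 2)
      = ∑ p ∈ range (n + 1), ∑ o ∈ range 3, c o p / (t + p + 1 / 2) ^ (o + 1) := by
    rw [BallRivoal.pfEval]
    refine sum_congr rfl fun p _ => sum_congr rfl fun o _ => ?_
    congr 2; ring
  rw [← e, h, inv_mul_cancel_left₀ (by positivity)]

/-- **(17) at natural arguments** (no side condition: `t + k + ½ ≠ 0`).
[cite: Zudilin2003Catalan, Lemma 1, eq. (17)] -/
theorem R_natCast_eq_pfEval (n : ℕ) (c : ℕ → ℕ → ℚ)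
    (hc : ∀ τ : ℚ, (∀ m, m ≤ n → τ + m + 1 ≠ 0) →
      BallRivoal.pfEval n 3 c τ = (16 : ℚ) ^ n * R n (τ + 1 / 2))
    (t : ℕ) :
    R n t = ((16 : ℚ) ^ n)⁻¹ * ∑ p ∈ range (n + 1), ∑ o ∈ range 3, c o p / ((t : ℚ) + p + 1 / 2) ^ (o + 1) :=
  R_eq_pfEval n c hc t fun k _ h => by
    have : (0 : ℚ) < (t : ℚ) + k + 1 / 2 := by positivity
    exact this.ne' h

end Literature.NumberTheory.Irrationality.Zudilin2003
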